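import Summits.ABC.ABC.Theorems.IneffectiveSubspaceUniformSadicTowerFourNormalForm
import Summits.ABC.ABC.Theorems.IneffectiveSubspaceAbcGivesUniformSadic

/-!
# `UniformSadicTowerFour` (stmt-ABC-14937), line `flat-steep-split` (lead c4): the crux — already its
# level-one rung at budget `K = 3` — implies the ONE-PRIME / TWO-BASE divisibility bound UPD(1,2)

The crux `UniformSadicTowerFour` ("Ridout at level four") implies, at every budget `K`, the LEVEL-ONE
RUNG: for every `ε > 0` there is `C` with `c < C · ((∏_{p ∈ S} p) · {abc}^S)^(1+ε)` for every abc triple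
`(a, b, c)` and every set `S` of at most `K` primes, where `{m}^S := ∏_{ℓ ∣ m, ℓ ∉ S} ℓ^{v_ℓ(m)}` is the
`S`-free part of `m` (landed: `MixedRadical.levelOneRung_of_uniformSadicTowerFour`).  Lead c4's normal
form of the first open rung `W = 3` of the crux's necessary condition BoundedOmegaABC is the
ONE-PRIME / TWO-BASE divisibility bound **UPD(1,2)**: for every `ε > 0` there is `C` such that for all
distinct primes `p, q, r` and all `Y, Z, t ∈ ℕ`

* if `p^t ∣ q^Y r^Z − 1` (and `q^Y r^Z ≥ 2`), or
* if `p^t ∣ r^Z − q^Y` (and `q^Y < r^Z`),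

then `p^t ≤ C · (pqr)^(1+ε) · (q^Y r^Z)^ε` — the `p`-part of `q^Y r^Z − 1`, resp. of `r^Z − q^Y`, is
sub-polynomially small.  This file proves the NECESSITY half of the sandwich
`crux ⟹ UPD(1,2) ⟹ rung W = 3`:

* `onePrimeTwoBase_of_levelOneRung` — the level-one rung at budget `K = 3` implies UPD(1,2), with the
  SAME constant `C(ε)`;
* `onePrimeTwoBase_of_uniformSadicTowerFour` — hence the crux implies UPD(1,2);
* `onePrimeTwoBase_of_abc` — hence so does `ABC` (through `abcGivesUniformSadic_proof`).

**Proof.** Fix `ε`, take the rung's `C`.  Given the data, read the rung at `S := {p, q, r}` on the abc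
triple `(1, q^Y r^Z − 1, q^Y r^Z)` (product case) resp. `(q^Y, r^Z − q^Y, r^Z)` (difference case;
coprime because `q ≠ r`).  In both cases `p^t ∣ b`, and the primes of `a` and `c` lie in `S`.  The
`S`-free part `T := {abc}^S` divides `abc` (unique factorisation) and is coprime to `p, q, r` (its primes
lie outside `S`), hence coprime to `a`, `c` and `p^t`; so `T ∣ b` and `T · p^t ∣ b`, whence the integer
inequality `B · p^t ≤ (pqr) · b` for the bracket `B := (∏_{x ∈ S} x) · T = pqr · T`
(`onePrime_bracket_mul_le`).  On the real side (`onePrime_real`), `p^t ≥ 1` and `b ≤ c` give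
`c · p^t ≤ c · (p^t)^(1+ε) < C · (B p^t)^(1+ε) ≤ C · (pqr · c)^(1+ε) = C (pqr)^(1+ε) c^ε · c`, so
`p^t < C (pqr)^(1+ε) c^ε`, and finally `c ≤ q^Y r^Z`.

Sources: the crux notes of the line `flat-steep-split` (`Cruxes/UniformSadicTowerFour/`, lead c4: the
sandwich crux ⟹ UPD ⟹ rung `W = 3`); the argument is elementary unique factorisation [folklore].  Mathlib
only (`Nat.prod_factorization_pow_eq_self`, `Finset.prod_dvd_prod_of_subset`, `Nat.Coprime.prod_left`,
`Nat.Coprime.mul_dvd_of_dvd_of_dvd`, `Finset.card_le_three`, `Real.mul_rpow`, `Real.rpow_add`,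
`Real.self_le_rpow_of_one_le`, `Real.rpow_le_rpow`) plus the landed
`MixedRadical.levelOneRung_of_uniformSadicTowerFour` and `abcGivesUniformSadic_proof`.  No new
definitions.  Deliberately NOT here: UPD(1,2) itself (OPEN, abc-type) and its sufficiency for the rung
`W = 3` (sibling file `…ThreeSlotOnePrime.lean`).
-/

noncomputable section

-- `Summit.<Summit>.<Problem>` is the mandated summit-side namespace (CONVENTIONS §2); for the
-- single-conjunct summit `ABC` the two coincide, so the duplicate `ABC.ABC` is deliberate.
set_option linter.dupNamespace false

namespace Summit.ABC.ABC.Theorems.UniformSadicTowerFour.BoundedOmega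

open Literature.NumberTheory.DiophantineGeometry (IsABCTriple rad rad_def)
open Summit.ABC.ABC.Theses.IneffectiveSubspace (UniformSadicTowerFour)
open Summit.ABC.ABC.Theorems.UniformSadicTowerFour.MixedRadical (levelOneRung_of_uniformSadicTowerFour)
open scoped BigOperators

/-! ## The `S`-free part: divisibility and coprimality -/

/-- **The `S`-free part divides:** `{M}^S = ∏_{ℓ ∣ M, ℓ ∉ S} ℓ^{v_ℓ(M)}` divides
`M = ∏_{ℓ ∣ M} ℓ^{v_ℓ(M)}` (unique factorisation; a sub-product of a product divides it). [folklore] -/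
theorem onePrime_sfree_dvd (M : ℕ) (S : Finset ℕ) :
    (∏ ℓ ∈ M.primeFactors \ S, ℓ ^ M.factorization ℓ) ∣ M := by
  rcases eq_or_ne M 0 with rfl | hM
  · exact dvd_zero _
  have hfull : ∏ ℓ ∈ M.primeFactors, ℓ ^ M.factorization ℓ = M := by
    conv_rhs => rw [← Nat.prod_factorization_pow_eq_self hM,
      Nat.prod_factorization_eq_prod_primeFactors]
  conv_rhs => rw [← hfull]
  exact Finset.prod_dvd_prod_of_subset _ _ _ Finset.sdiff_subset

/-- **The `S`-free part is prime to `S`:** `{M}^S` is coprime to every prime `x ∈ S` (each factor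
`ℓ^{v_ℓ(M)}` has `ℓ` prime and `ℓ ∉ S`, so `ℓ ≠ x`). [folklore] -/
theorem onePrime_sfree_coprime {M : ℕ} {S : Finset ℕ} {x : ℕ} (hx : x.Prime) (hxS : x ∈ S) :
    Nat.Coprime (∏ ℓ ∈ M.primeFactors \ S, ℓ ^ M.factorization ℓ) x := by
  refine Nat.Coprime.prod_left fun ℓ hℓ => ?_
  obtain ⟨hℓF, hℓS⟩ := Finset.mem_sdiff.1 hℓ
  have hℓp : ℓ.Prime := Nat.prime_of_mem_primeFactors hℓF
  have hne : ℓ ≠ x := fun h => hℓS (h ▸ hxS)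
  exact ((Nat.coprime_primes hℓp hx).2 hne).pow_left _

/-! ## The integer inequality: bracket `· p^t ≤ pqr · b` -/

/-- **The integer heart.** Let `(a, b, c)` be an abc triple, `p, q, r` distinct with `p` prime,
`p^t ∣ b`, and suppose the `S`-free part `T := {abc}^S` (`S = {p, q, r}`) is coprime to `a` and to
`c`.  Then `T ∣ abc` forces `T ∣ b`, `T` is prime to `p^t`, so `T · p^t ∣ b` and the bracket
`B = (∏_{x ∈ S} x) · T = pqr · T` satisfies `B · p^t ≤ pqr · b`. [folklore] -/
theorem onePrime_bracket_mul_le {a b c p q r t : ℕ} (habc : IsABCTriple a b c) (hp : p.Prime)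
    (hpq : p ≠ q) (hpr : p ≠ r) (hqr : q ≠ r) (ht : p ^ t ∣ b)
    (hTa : Nat.Coprime
      (∏ ℓ ∈ (a * b * c).primeFactors \ {p, q, r}, ℓ ^ (a * b * c).factorization ℓ) a)
    (hTc : Nat.Coprime
      (∏ ℓ ∈ (a * b * c).primeFactors \ {p, q, r}, ℓ ^ (a * b * c).factorization ℓ) c) :
    ((∏ x ∈ ({p, q, r} : Finset ℕ), x) *
        ∏ ℓ ∈ (a * b * c).primeFactors \ {p, q, r}, ℓ ^ (a * b * c).factorization ℓ) * p ^ t ≤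
      p * q * r * b := by
  obtain ⟨-, hb, -, -⟩ := habc
  have hTabc := onePrime_sfree_dvd (a * b * c) {p, q, r}
  have hTb := hTa.dvd_of_dvd_mul_left (hTc.dvd_of_dvd_mul_right hTabc)
  have hTp := (onePrime_sfree_coprime (M := a * b * c) hp
    (by simp : p ∈ ({p, q, r} : Finset ℕ))).pow_right t
  have hle := Nat.le_of_dvd hb (hTp.mul_dvd_of_dvd_of_dvd hTb ht)
  have hprod : ∏ x ∈ ({p, q, r} : Finset ℕ), x = p * q * r := by
    rw [Finset.prod_insert (by simp [hpq, hpr]), Finset.prod_insert (by simp [hqr]),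
      Finset.prod_singleton, mul_assoc]
  rw [hprod, mul_assoc]
  exact Nat.mul_le_mul_left _ hle

/-! ## The real inequality -/

/-- **The real step.** From the rung `c < C · B^(1+ε)`, the integer inequality `B · P ≤ R · b`,
`b ≤ c`, `0 < c` and `1 ≤ P`:  `P · c ≤ P^(1+ε) · c < C (B P)^(1+ε) ≤ C (R c)^(1+ε) = C R^(1+ε) c^ε · c`,
hence `P ≤ C · R^(1+ε) · c^ε`. [folklore] -/
theorem onePrime_real {c b B P R : ℕ} {C ε : ℝ} (hC : 0 < C) (hε : 0 < ε) (hc : 0 < c)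
    (hlt : (c : ℝ) < C * ((B : ℕ) : ℝ) ^ (1 + ε)) (hBP : B * P ≤ R * b) (hbc : b ≤ c)
    (hP : 1 ≤ P) :
    ((P : ℕ) : ℝ) ≤ C * ((R : ℕ) : ℝ) ^ (1 + ε) * ((c : ℕ) : ℝ) ^ ε := by
  have hcR : (0 : ℝ) < c := by exact_mod_cast hc
  have hP1 : (1 : ℝ) ≤ P := by exact_mod_cast hP
  have hε1 : (0 : ℝ) ≤ 1 + ε := by linarith
  have hB0 : (0 : ℝ) ≤ B := Nat.cast_nonneg _
  have hP0 : (0 : ℝ) ≤ P := Nat.cast_nonneg _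
  have hR0 : (0 : ℝ) ≤ R := Nat.cast_nonneg _
  have hBPR : (B : ℝ) * P ≤ (R : ℝ) * c := by
    exact_mod_cast hBP.trans (Nat.mul_le_mul_left R hbc)
  have hPε : (0 : ℝ) < (P : ℝ) ^ (1 + ε) := Real.rpow_pos_of_pos (by linarith) _
  have key : (P : ℝ) * c < C * (R : ℝ) ^ (1 + ε) * (c : ℝ) ^ ε * c := by
    calc (P : ℝ) * c ≤ (P : ℝ) ^ (1 + ε) * c :=
          mul_le_mul_of_nonneg_right (Real.self_le_rpow_of_one_le hP1 (by linarith)) hcR.le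
      _ < (P : ℝ) ^ (1 + ε) * (C * (B : ℝ) ^ (1 + ε)) := mul_lt_mul_of_pos_left hlt hPε
      _ = C * ((B : ℝ) * P) ^ (1 + ε) := by
          rw [Real.mul_rpow hB0 hP0]; ring
      _ ≤ C * ((R : ℝ) * c) ^ (1 + ε) :=
          mul_le_mul_of_nonneg_left (Real.rpow_le_rpow (mul_nonneg hB0 hP0) hBPR hε1) hC.le
      _ = C * (R : ℝ) ^ (1 + ε) * (c : ℝ) ^ ε * c := by
          rw [Real.mul_rpow hR0 hcR.le, Real.rpow_add hcR, Real.rpow_one]; ring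
  exact (lt_of_mul_lt_mul_right key hcR.le).le

/-! ## The theorems -/

/-- **Level-one rung at budget `3` ⟹ UPD(1,2)** (same constant `C(ε)`).  For distinct primes `p, q, r`
and `Y, Z, t ∈ ℕ`: if `p^t ∣ q^Y r^Z − 1` with `q^Y r^Z ≥ 2` (read the rung at `S = {p, q, r}` on the abc
triple `(1, q^Y r^Z − 1, q^Y r^Z)`), or `p^t ∣ r^Z − q^Y` with `q^Y < r^Z` (on `(q^Y, r^Z − q^Y, r^Z)`),
then `p^t ≤ C · (pqr)^(1+ε) · (q^Y r^Z)^ε`: the `S`-free part of `abc` times `p^t` divides `b < c`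
(`onePrime_bracket_mul_le`, `onePrime_real`), and `c ≤ q^Y r^Z`. [folklore] -/
theorem onePrimeTwoBase_of_levelOneRung
    (h : ∀ ε : ℝ, 0 < ε → ∃ C : ℝ, 0 < C ∧ ∀ S : Finset ℕ, S.card ≤ 3 → (∀ p ∈ S, Nat.Prime p) →
      ∀ a b c : ℕ, IsABCTriple a b c →
        (c : ℝ) < C * ((((∏ p ∈ S, p) *
          ∏ p ∈ (a * b * c).primeFactors \ S, p ^ (a * b * c).factorization p : ℕ) : ℝ)) ^ (1 + ε)) :
    ∀ ε : ℝ, 0 < ε → ∃ C : ℝ, 0 < C ∧ ∀ p q r : ℕ, p.Prime → q.Prime → r.Prime →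
      p ≠ q → p ≠ r → q ≠ r → ∀ Y Z t : ℕ,
      (p ^ t ∣ q ^ Y * r ^ Z - 1 ∧ 2 ≤ q ^ Y * r ^ Z) ∨ (p ^ t ∣ r ^ Z - q ^ Y ∧ q ^ Y < r ^ Z) →
      ((p ^ t : ℕ) : ℝ) ≤ C * ((p * q * r : ℕ) : ℝ) ^ (1 + ε) * ((q ^ Y * r ^ Z : ℕ) : ℝ) ^ ε := by
  intro ε hε
  obtain ⟨C, hC, hS⟩ := h ε hε
  refine ⟨C, hC, ?_⟩
  intro p q r hp hq hr hpq hpr hqr Y Z t hyp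
  have hcard : ({p, q, r} : Finset ℕ).card ≤ 3 := Finset.card_le_three
  have hprime : ∀ x ∈ ({p, q, r} : Finset ℕ), x.Prime := by
    intro x hx
    simp only [Finset.mem_insert, Finset.mem_singleton] at hx
    rcases hx with rfl | rfl | rfl <;> assumption
  have hP : 1 ≤ p ^ t := Nat.one_le_pow _ _ hp.pos
  have hqY : 0 < q ^ Y := pow_pos hq.pos _
  have hrZ : 0 < r ^ Z := pow_pos hr.pos _
  have hqS : q ∈ ({p, q, r} : Finset ℕ) := by simp
  have hrS : r ∈ ({p, q, r} : Finset ℕ) := by simp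
  rcases hyp with ⟨hdvd, h2⟩ | ⟨hdvd, hlt⟩
  · -- product case: the abc triple `(1, q^Y r^Z - 1, q^Y r^Z)`
    have habc : IsABCTriple 1 (q ^ Y * r ^ Z - 1) (q ^ Y * r ^ Z) :=
      ⟨one_pos, by omega, by omega, Nat.coprime_one_left _⟩
    have hrung := hS {p, q, r} hcard hprime 1 (q ^ Y * r ^ Z - 1) (q ^ Y * r ^ Z) habc
    have hnat := onePrime_bracket_mul_le habc hp hpq hpr hqr hdvd (Nat.coprime_one_right _)
      (((onePrime_sfree_coprime hq hqS).pow_right Y).mul_right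
        ((onePrime_sfree_coprime hr hrS).pow_right Z))
    exact onePrime_real hC hε (by omega) hrung hnat (by omega) hP
  · -- difference case: the abc triple `(q^Y, r^Z - q^Y, r^Z)`
    have hcop : Nat.Coprime (q ^ Y) (r ^ Z - q ^ Y) :=
      (Nat.coprime_sub_self_right hlt.le).2 (Nat.Coprime.pow Y Z ((Nat.coprime_primes hq hr).2 hqr))
    have habc : IsABCTriple (q ^ Y) (r ^ Z - q ^ Y) (r ^ Z) := ⟨hqY, by omega, by omega, hcop⟩
    have hrung := hS {p, q, r} hcard hprime (q ^ Y) (r ^ Z - q ^ Y) (r ^ Z) habc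
    have hnat := onePrime_bracket_mul_le habc hp hpq hpr hqr hdvd
      ((onePrime_sfree_coprime hq hqS).pow_right Y) ((onePrime_sfree_coprime hr hrS).pow_right Z)
    have hmain := onePrime_real hC hε hrZ hrung hnat (by omega) hP
    have hcle : ((r ^ Z : ℕ) : ℝ) ≤ ((q ^ Y * r ^ Z : ℕ) : ℝ) := by
      exact_mod_cast Nat.le_mul_of_pos_left (r ^ Z) hqY
    calc ((p ^ t : ℕ) : ℝ) ≤ C * ((p * q * r : ℕ) : ℝ) ^ (1 + ε) * ((r ^ Z : ℕ) : ℝ) ^ ε := hmain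
      _ ≤ C * ((p * q * r : ℕ) : ℝ) ^ (1 + ε) * ((q ^ Y * r ^ Z : ℕ) : ℝ) ^ ε :=
          mul_le_mul_of_nonneg_left (Real.rpow_le_rpow (Nat.cast_nonneg _) hcle hε.le)
            (mul_nonneg hC.le (Real.rpow_nonneg (Nat.cast_nonneg _) _))

/-- **Crux ⟹ UPD(1,2).** `UniformSadicTowerFour` ("Ridout at level four") implies the one-prime /
two-base divisibility bound: for every `ε > 0` some `C` bounds the `p`-part of `q^Y r^Z − 1` (when
`q^Y r^Z ≥ 2`) and of `r^Z − q^Y` (when `q^Y < r^Z`) by `C · (pqr)^(1+ε) · (q^Y r^Z)^ε`, for all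
distinct primes `p, q, r` — through the crux's level-one rung at budget `K = 3`
(`MixedRadical.levelOneRung_of_uniformSadicTowerFour`). [folklore] -/
theorem onePrimeTwoBase_of_uniformSadicTowerFour (hU : UniformSadicTowerFour) :
    ∀ ε : ℝ, 0 < ε → ∃ C : ℝ, 0 < C ∧ ∀ p q r : ℕ, p.Prime → q.Prime → r.Prime →
      p ≠ q → p ≠ r → q ≠ r → ∀ Y Z t : ℕ,
      (p ^ t ∣ q ^ Y * r ^ Z - 1 ∧ 2 ≤ q ^ Y * r ^ Z) ∨ (p ^ t ∣ r ^ Z - q ^ Y ∧ q ^ Y < r ^ Z) →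
      ((p ^ t : ℕ) : ℝ) ≤ C * ((p * q * r : ℕ) : ℝ) ^ (1 + ε) * ((q ^ Y * r ^ Z : ℕ) : ℝ) ^ ε :=
  onePrimeTwoBase_of_levelOneRung (levelOneRung_of_uniformSadicTowerFour hU 3)

/-- **ABC ⟹ UPD(1,2).** The abc conjecture implies the one-prime / two-base divisibility bound,
through `ABC ⟹ UniformSadicTowerFour` (`abcGivesUniformSadic_proof`) and
`onePrimeTwoBase_of_uniformSadicTowerFour`. [folklore] -/
theorem onePrimeTwoBase_of_abc (h : ABC) :
    ∀ ε : ℝ, 0 < ε → ∃ C : ℝ, 0 < C ∧ ∀ p q r : ℕ, p.Prime → q.Prime → r.Prime →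
      p ≠ q → p ≠ r → q ≠ r → ∀ Y Z t : ℕ,
      (p ^ t ∣ q ^ Y * r ^ Z - 1 ∧ 2 ≤ q ^ Y * r ^ Z) ∨ (p ^ t ∣ r ^ Z - q ^ Y ∧ q ^ Y < r ^ Z) →
      ((p ^ t : ℕ) : ℝ) ≤ C * ((p * q * r : ℕ) : ℝ) ^ (1 + ε) * ((q ^ Y * r ^ Z : ℕ) : ℝ) ^ ε :=
  onePrimeTwoBase_of_uniformSadicTowerFour (abcGivesUniformSadic_proof h)

end Summit.ABC.ABC.Theorems.UniformSadicTowerFour.BoundedOmega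

end
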